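import Literature.Topology.FourManifolds.ConnectedSum
import HarnessLib

/-!
# Transport of open gluings along diffeomorphisms (proofs; corrected form of a mis-stated fact)

The named fact `Literature.Topology.FourManifolds.IsOpenGluing.of_diffeomorph` (file `ConnectedSum`) asserts that an open gluing
`IsOpenGluing IA IB IP (P := P) R` is transported along any diffeomorphism `e : P ≃ₘ⟮IP, IP'⟯ P'`
for two *arbitrary* models with corners `IP : ModelWithCorners ℝ EP HP`,
`IP' : ModelWithCorners ℝ EP HP'` on the same vector space. In that generality it is **false**
(machine-checked refutation: `Literature.Topology.FourManifolds.OpenGluingCounterexample.not_isOpenGluing_of_diffeomorph`, file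
`OpenGluingCounterexample`): Mathlib's immersions/smooth embeddings require charts of the maximal
atlases in which the map is *linear*, so the germs of `range IP` and `range IP'` at corresponding
points must be linearly equivalent, whereas a diffeomorphism only identifies them by a map smooth
*within* these sets (counterexample: the models `{y ≥ x²}` and `{y ≥ 0}` in `ℝ²`, related by the
shear `(x, y) ↦ (x, y - x²)`).

The source (A. Kosinski, *Differential Manifolds* (1993), Ch. VI §1, proof of Thm (1.1), (∗); all
manifolds there are modelled on `ℝᵐ` or `ℝᵐ₊`, I.(1.1)) works with ONE standard model. This file
proves the transport under the hypothesis `range IP' = range IP` (in particular for `IP' = IP`,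
Kosinski's setting, and for any two boundaryless models). Everything here is a theorem: no new
definition, and no statement of `ConnectedSum.lean` is changed (this is a sibling proofs file of
`ConnectedSum`).

* `Literature.Topology.FourManifolds.IsOpenGluing.of_diffeomorph_of_range_eq` — the **corrected statement** of the named fact,
  proved (same binder shape as the original, plus `range IP' = range IP`, minus the superfluous
  `[IsManifold IP ∞ P]`); its dot-notation form is `Literature.IsOpenGluing.diffeomorph_comp h e hI`
  (post-composition of the two gluing embeddings with `e`; the name `comp_diffeomorph` is kept
  free for re-gluing through a diffeomorphism of a *piece*, as in
  `Literature.Topology.FourManifolds.IsClosedGluing.comp_diffeomorph`);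
* `Literature.Topology.FourManifolds.IsOpenGluing.diffeomorph_comp_of_boundaryless` — the corollary for two boundaryless models;
* `Literature.Topology.FourManifolds.IsOpenGluing.of_diffeomorph_holds_of_range_eq`, `…_holds_self`, `…_holds_of_boundaryless` —
  the TRUE instances of the original named fact `Literature.Topology.FourManifolds.IsOpenGluing.of_diffeomorph` (fixed models with
  `range IP' = range IP`, resp. `IP' = IP`, resp. both boundaryless), so that consumers carrying
  `(hdiff : IsOpenGluing.of_diffeomorph …)` for such models can be fed a proof. (A discharge
  `of_diffeomorph_holds` of the fact as stated is impossible: it is refuted.)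

Method: a chart `ψ` of `P` in the maximal `C^∞` atlas is transported to the chart
`IP'.symm ∘ IP ∘ ψ ∘ e.symm` of `P'` (`Literature.Topology.FourManifolds.exists_transportChart`), which lies in the maximal atlas
of `P'` because it and its inverse are `C^∞` (`IsManifold.mem_maximalAtlas_iff_contMDiffOn`), and
in these charts `e ∘ jA` has the same linear local form as `jA`
(`Literature.Topology.FourManifolds.isImmersionAtOfComplement_diffeomorph_comp_of_range_eq`). Only `[IsManifold IP' ∞ P']` is
needed (the hypothesis `[IsManifold IP ∞ P]` of the original fact is unnecessary). The lemmas
`Literature.Topology.FourManifolds.isImmersionAtOfComplement_diffeomorph_comp_of_range_eq`,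
`Literature.Topology.FourManifolds.isImmersion_diffeomorph_comp_of_range_eq`, `Literature.Topology.FourManifolds.isSmoothEmbedding_diffeomorph_comp_of_range_eq`
are the equal-range, `C^∞` counterparts of the same-model, all-`n` lemmas
`Manifold.IsImmersionAtOfComplement.diffeomorph_comp`, `Manifold.IsImmersion.diffeomorph_comp`,
`Manifold.IsSmoothEmbedding.diffeomorph_comp` of `ClosedBallProofs.lean` (a different model `IP'`
of equal range is needed here, which those do not cover).

## References
* A. Kosinski, *Differential Manifolds*, Academic Press (1993), Ch. VI §1, Thm (1.1) and its proof;
  Ch. I (1.1)–(1.2) (structures are transported along homeomorphisms).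
  [cite: Kosinski1993, Ch. VI §1]
-/

open scoped Manifold ContDiff Topology
open Set Module

noncomputable section

namespace Literature.Topology.FourManifolds

/-! ### Homeomorphism of model spaces with equal range -/

section ModelHomeomorph

variable {E H H' : Type*} [NormedAddCommGroup E] [NormedSpace ℝ E] [TopologicalSpace H]
  [TopologicalSpace H'] {I : ModelWithCorners ℝ E H} {I' : ModelWithCorners ℝ E H'}

/-- Two models with corners `I : H → E`, `I' : H' → E` on the same vector space with the same range
have homeomorphic model spaces, via `I'.symm ∘ I : H ≃ₜ H'` with inverse `I.symm ∘ I'`; both maps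
are `C^∞` for the models `I`, `I'` (in charts they are the identity of the common range).
(Kosinski, *Differential Manifolds*, I.(1.1)–(1.2).) [folklore] -/
theorem exists_modelHomeomorph_of_range_eq (h : range I' = range I) :
    ∃ φ : H ≃ₜ H', ContMDiff I I' ∞ φ ∧ ContMDiff I' I ∞ φ.symm ∧
      (∀ x, φ x = I'.symm (I x)) ∧ ∀ y, φ.symm y = I.symm (I' y) := by
  let φ : H ≃ₜ H' :=
    { toFun := I'.symm ∘ I
      invFun := I.symm ∘ I'
      left_inv := fun x => by
        simp only [Function.comp_apply]
        rw [I'.right_inv (by rw [h]; exact mem_range_self x), I.left_inv]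
      right_inv := fun x => by
        simp only [Function.comp_apply]
        rw [I.right_inv (by rw [← h]; exact mem_range_self x), I'.left_inv]
      continuous_toFun := I'.continuous_symm.comp I.continuous
      continuous_invFun := I.continuous_symm.comp I'.continuous }
  refine ⟨φ, ?_, ?_, fun x => rfl, fun y => rfl⟩
  · have h1 : ContMDiffOn 𝓘(ℝ, E) I' ∞ I'.symm (range I') := I'.contMDiffOn_symm
    exact h1.comp_contMDiff I.contMDiff (fun x => by rw [h]; exact mem_range_self x)
  · have h1 : ContMDiffOn 𝓘(ℝ, E) I ∞ I.symm (range I) := I.contMDiffOn_symm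
    exact h1.comp_contMDiff I'.contMDiff (fun x => by rw [← h]; exact mem_range_self x)

end ModelHomeomorph

/-! ### Transport of charts and immersions along a diffeomorphism -/

section TransportChart

variable {EA HA EP HP HP' : Type*}
  [NormedAddCommGroup EA] [NormedSpace ℝ EA] [TopologicalSpace HA] {IA : ModelWithCorners ℝ EA HA}
  [NormedAddCommGroup EP] [NormedSpace ℝ EP] [TopologicalSpace HP] {IP : ModelWithCorners ℝ EP HP}
  [TopologicalSpace HP'] {IP' : ModelWithCorners ℝ EP HP'}
  {A P P' : Type*} [TopologicalSpace A] [ChartedSpace HA A]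
  [TopologicalSpace P] [ChartedSpace HP P] [TopologicalSpace P'] [ChartedSpace HP' P']

/-- **Transport of a chart along a diffeomorphism.** A chart `ψ` of the maximal `C^∞` atlas of `P`
is transported along a diffeomorphism `e : P ≃ₘ⟮IP, IP'⟯ P'` (models of equal range) to a chart
`χ = IP'.symm ∘ IP ∘ ψ ∘ e.symm` of the maximal `C^∞` atlas of the manifold `P'`, with source
`e.symm ⁻¹' ψ.source`: the transported chart and its inverse are `C^∞`
(`IsManifold.mem_maximalAtlas_iff_contMDiffOn`). (Kosinski, *Differential Manifolds*,
I.(1.1)–(1.2): structures are transported along homeomorphisms.) [folklore] -/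
theorem exists_transportChart [IsManifold IP' ∞ P'] (e : P ≃ₘ⟮IP, IP'⟯ P')
    (hI : range IP' = range IP) {ψ : OpenPartialHomeomorph P HP}
    (hψ : ψ ∈ IsManifold.maximalAtlas IP ∞ P) :
    ∃ χ : OpenPartialHomeomorph P' HP', χ ∈ IsManifold.maximalAtlas IP' ∞ P' ∧
      χ.source = e.symm ⁻¹' ψ.source ∧ ∀ x, χ x = IP'.symm (IP (ψ (e.symm x))) := by
  obtain ⟨φ, hφ, hφs, hφx, -⟩ := exists_modelHomeomorph_of_range_eq (I := IP) (I' := IP') hI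
  refine ⟨(e.symm.toHomeomorph.transOpenPartialHomeomorph ψ).transHomeomorph φ, ?_, rfl,
    fun x => ?_⟩
  · apply OpenPartialHomeomorph.mem_maximalAtlas_of_contMDiffOn
    · have h1 : ContMDiffOn IP IP ∞ ψ ψ.source := contMDiffOn_of_mem_maximalAtlas hψ
      have h2 : ContMDiffOn IP' IP ∞ (ψ ∘ e.symm) (e.symm ⁻¹' ψ.source) :=
        h1.comp e.symm.contMDiff.contMDiffOn (fun x hx => hx)
      have h3 := hφ.comp_contMDiffOn h2
      exact h3.congr_mono (fun x _ => rfl) subset_rfl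
    · have h1 : ContMDiffOn IP IP ∞ ψ.symm ψ.target := contMDiffOn_symm_of_mem_maximalAtlas hψ
      have h2 : ContMDiffOn IP' IP ∞ (ψ.symm ∘ φ.symm) (φ.symm ⁻¹' ψ.target) :=
        h1.comp hφs.contMDiffOn (fun x hx => hx)
      have h3 := e.contMDiff.comp_contMDiffOn h2
      exact h3.congr_mono (fun x _ => rfl) subset_rfl
  · exact hφx _

/-- Post-composing a `C^∞` immersion at `a` (with complement `F`) with a diffeomorphism
`e : P ≃ₘ⟮IP, IP'⟯ P'` onto a manifold whose model has the same range gives an immersion at `a`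
with the same complement: keep the domain chart and the linear equivalence, transport the codomain
chart (`exists_transportChart`). (Special case of Mathlib's TODO `IsImmersionAt.comp`; the
same-model, all-`n` version is `Manifold.IsImmersionAtOfComplement.diffeomorph_comp` in
`ClosedBallProofs.lean`.) [folklore] -/
theorem isImmersionAtOfComplement_diffeomorph_comp_of_range_eq [IsManifold IP' ∞ P'] {F : Type*}
    [NormedAddCommGroup F] [NormedSpace ℝ F] {f : A → P} {a : A}
    (h : Manifold.IsImmersionAtOfComplement F IA IP ∞ f a) (e : P ≃ₘ⟮IP, IP'⟯ P')
    (hI : range IP' = range IP) : Manifold.IsImmersionAtOfComplement F IA IP' ∞ (e ∘ f) a := by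
  obtain ⟨χ, hχ, hsrc, hχx⟩ := exists_transportChart e hI h.codChart_mem_maximalAtlas
  refine Manifold.IsImmersionAtOfComplement.mk_of_charts h.equiv h.domChart χ
    h.mem_domChart_source ?_ h.domChart_mem_maximalAtlas hχ ?_ ?_
  · rw [hsrc]
    simpa using h.mem_codChart_source
  · intro x hx
    show (e ∘ f) x ∈ χ.source
    rw [hsrc]
    simpa using h.source_subset_preimage_source hx
  · intro u hu
    have := h.writtenInCharts hu
    simp only [Function.comp_apply, OpenPartialHomeomorph.extend_coe] at this ⊢
    rw [← this, hχx]
    simp only [Diffeomorph.symm_apply_apply]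
    rw [IP'.right_inv]
    rw [hI]; exact mem_range_self _

/-- Post-composing a `C^∞` immersion with a diffeomorphism onto a manifold whose model has the
same range gives an immersion (same global complement). (Same-model, all-`n` version:
`Manifold.IsImmersion.diffeomorph_comp` in `ClosedBallProofs.lean`.) [folklore] -/
theorem isImmersion_diffeomorph_comp_of_range_eq [IsManifold IP' ∞ P'] {f : A → P}
    (hf : Manifold.IsImmersion IA IP ∞ f) (e : P ≃ₘ⟮IP, IP'⟯ P') (hI : range IP' = range IP) :
    Manifold.IsImmersion IA IP' ∞ (e ∘ f) := by
  obtain ⟨F, _, _, h⟩ := hf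
  exact ⟨F, inferInstance, inferInstance,
    fun x => isImmersionAtOfComplement_diffeomorph_comp_of_range_eq (h x) e hI⟩

/-- Post-composing a `C^∞` embedding with a diffeomorphism onto a manifold whose model has the
same range gives a `C^∞` embedding (special case of Mathlib's `proof_wanted`
`IsSmoothEmbedding.comp`; same-model, all-`n` version: `Manifold.IsSmoothEmbedding.diffeomorph_comp`
in `ClosedBallProofs.lean`). [folklore] -/
theorem isSmoothEmbedding_diffeomorph_comp_of_range_eq [IsManifold IP' ∞ P'] {f : A → P}
    (hf : Manifold.IsSmoothEmbedding IA IP ∞ f) (e : P ≃ₘ⟮IP, IP'⟯ P')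
    (hI : range IP' = range IP) : Manifold.IsSmoothEmbedding IA IP' ∞ (e ∘ f) :=
  ⟨isImmersion_diffeomorph_comp_of_range_eq hf.isImmersion e hI,
    e.toHomeomorph.isEmbedding.comp hf.isEmbedding⟩

end TransportChart

/-! ### Transport of open gluings -/

section GluingTransport

variable {EA HA EB HB EP HP HP' : Type*}
  [NormedAddCommGroup EA] [NormedSpace ℝ EA] [TopologicalSpace HA] {IA : ModelWithCorners ℝ EA HA}
  [NormedAddCommGroup EB] [NormedSpace ℝ EB] [TopologicalSpace HB] {IB : ModelWithCorners ℝ EB HB}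
  [NormedAddCommGroup EP] [NormedSpace ℝ EP] [TopologicalSpace HP] {IP : ModelWithCorners ℝ EP HP}
  [TopologicalSpace HP'] {IP' : ModelWithCorners ℝ EP HP'}
  {A B P P' : Type*} [TopologicalSpace A] [ChartedSpace HA A] [TopologicalSpace B]
  [ChartedSpace HB B]
  [TopologicalSpace P] [ChartedSpace HP P] [TopologicalSpace P'] [ChartedSpace HP' P']

/-- **Transport of open gluings along diffeomorphisms** (post-composition of the gluing
embeddings with a diffeomorphism of the glued manifold; the corrected form of the named fact
`IsOpenGluing.of_diffeomorph`, see `IsOpenGluing.of_diffeomorph_of_range_eq`). If `P` is an open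
gluing of `A` and `B` along `R` and `e : P ≃ₘ⟮IP, IP'⟯ P'` is a diffeomorphism onto a `C^∞`
manifold `P'` whose model has the same range as that of `P` (e.g. `IP' = IP`, or both
boundaryless), then `P'` is an open gluing of `A` and `B` along `R`, via `e ∘ jA`, `e ∘ jB`
(Kosinski, *Differential Manifolds*, Ch. VI §1, proof of Thm (1.1), (∗): the smooth structure of a
gluing is the one for which the projections of the pieces are diffeomorphisms onto open subsets,
a property transported by diffeomorphisms).

Discrepancy with the original named fact: `IsOpenGluing.of_diffeomorph` quantifies over two
*arbitrary* models `IP`, `IP'` on `EP` and is false in that generality (refuted in file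
`OpenGluingCounterexample`: Mathlib immersion charts are linear, and the ranges of two models
related by a diffeomorphism need not be linearly related). The source works with ONE standard
model (`ℝᵐ` / `ℝᵐ₊`, I.(1.1)); the faithful formal rendering adds the hypothesis
`range IP' = range IP`, and the hypothesis `[IsManifold IP ∞ P]` of the original turns out to be
unnecessary. [cite: Kosinski1993, Ch. VI §1, proof of Thm 1.1] -/
theorem IsOpenGluing.diffeomorph_comp [IsManifold IP' ∞ P'] {R : A → B → Prop}
    (h : IsOpenGluing IA IB IP (P := P) R) (e : P ≃ₘ⟮IP, IP'⟯ P')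
    (hI : range IP' = range IP) : IsOpenGluing IA IB IP' (P := P') R := by
  obtain ⟨jA, jB, hA, hAo, hB, hBo, hU, hR⟩ := h
  refine ⟨e ∘ jA, e ∘ jB, isSmoothEmbedding_diffeomorph_comp_of_range_eq hA e hI, ?_,
    isSmoothEmbedding_diffeomorph_comp_of_range_eq hB e hI, ?_, ?_, fun a b => ?_⟩
  · rw [range_comp]; exact e.toHomeomorph.isOpenMap _ hAo
  · rw [range_comp]; exact e.toHomeomorph.isOpenMap _ hBo
  · rw [range_comp, range_comp, ← image_union, hU, image_univ, e.toEquiv.range_eq_univ.symm]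
    rfl
  · rw [← hR a b]
    exact e.injective.eq_iff

/-- **Corrected statement of the named fact `IsOpenGluing.of_diffeomorph`, proved.** Open
gluings are transported along diffeomorphisms `e : P ≃ₘ⟮IP, IP'⟯ P'` onto `C^∞` manifolds whose
model has the same range: `range IP' = range IP` (Kosinski, *Differential Manifolds*, Ch. VI §1,
proof of Thm (1.1), (∗), where all manifolds are modelled on one standard model `ℝᵐ` / `ℝᵐ₊`,
I.(1.1)). Same binder shape as the original fact, with the hypothesis `range IP' = range IP` added
(it is necessary: without it the statement is refuted in file `OpenGluingCounterexample`) and the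
superfluous `[IsManifold IP ∞ P]` dropped. This is `IsOpenGluing.diffeomorph_comp` with the
arguments reordered. [cite: Kosinski1993, Ch. VI §1, proof of Thm 1.1] -/
theorem IsOpenGluing.of_diffeomorph_of_range_eq [IsManifold IP' ∞ P'] (hI : range IP' = range IP)
    {R : A → B → Prop} (h : IsOpenGluing IA IB IP (P := P) R) (e : P ≃ₘ⟮IP, IP'⟯ P') :
    IsOpenGluing IA IB IP' (P := P') R :=
  h.diffeomorph_comp e hI

/-- The boundaryless case of the transport of open gluings: if both models `IP`, `IP'` have full
range (e.g. `𝓡 n`, `𝓘(ℝ, E)`, products of such), an open gluing is transported along any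
diffeomorphism `P ≃ₘ⟮IP, IP'⟯ P'` (Kosinski, Ch. VI §1).
[cite: Kosinski1993, Ch. VI §1, proof of Thm 1.1] -/
theorem IsOpenGluing.diffeomorph_comp_of_boundaryless [IP.Boundaryless] [IP'.Boundaryless]
    [IsManifold IP' ∞ P'] {R : A → B → Prop} (h : IsOpenGluing IA IB IP (P := P) R)
    (e : P ≃ₘ⟮IP, IP'⟯ P') : IsOpenGluing IA IB IP' (P := P') R :=
  h.diffeomorph_comp e (by rw [IP.range_eq_univ, IP'.range_eq_univ])

/-- **The instances of the (mis-stated) named fact `IsOpenGluing.of_diffeomorph` that are true.**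
For a fixed pair of models with `range IP' = range IP` (in particular `IP' = IP`, Kosinski's
setting of one standard model `ℝᵐ` / `ℝᵐ₊`), the original named fact
`IsOpenGluing.of_diffeomorph` holds as stated, by `IsOpenGluing.diffeomorph_comp`;
consumers that carry it as a hypothesis `(hdiff : IsOpenGluing.of_diffeomorph …)` for such models
can be fed this term. (For two unrelated models the fact is false: file
`OpenGluingCounterexample`.) [cite: Kosinski1993, Ch. VI §1, proof of Thm 1.1] -/
theorem IsOpenGluing.of_diffeomorph_holds_of_range_eq (hI : range IP' = range IP) :
    IsOpenGluing.of_diffeomorph (IA := IA) (IB := IB) (IP := IP) (IP' := IP') (A := A) (B := B)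
      (P := P) (P' := P') :=
  fun h e => h.diffeomorph_comp e hI

/-- The named fact `IsOpenGluing.of_diffeomorph` holds for two manifolds with the SAME model
(`IP' = IP`): transport along any diffeomorphism `P ≃ₘ⟮IP, IP⟯ Q`
(Kosinski, Ch. VI §1: one standard model). [cite: Kosinski1993, Ch. VI §1, proof of Thm 1.1] -/
theorem IsOpenGluing.of_diffeomorph_holds_self {Q : Type*} [TopologicalSpace Q]
    [ChartedSpace HP Q] :
    IsOpenGluing.of_diffeomorph (IA := IA) (IB := IB) (IP := IP) (IP' := IP) (A := A) (B := B)
      (P := P) (P' := Q) :=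
  IsOpenGluing.of_diffeomorph_holds_of_range_eq rfl

/-- The named fact `IsOpenGluing.of_diffeomorph` holds for any two boundaryless models `IP`, `IP'`
on `EP` (both have range `univ`). [cite: Kosinski1993, Ch. VI §1, proof of Thm 1.1] -/
theorem IsOpenGluing.of_diffeomorph_holds_of_boundaryless [IP.Boundaryless] [IP'.Boundaryless] :
    IsOpenGluing.of_diffeomorph (IA := IA) (IB := IB) (IP := IP) (IP' := IP') (A := A) (B := B)
      (P := P) (P' := P') :=
  IsOpenGluing.of_diffeomorph_holds_of_range_eq (by rw [IP.range_eq_univ, IP'.range_eq_univ])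

end GluingTransport

end Literature.Topology.FourManifolds
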